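import Literature.AlgebraicGeometry.Resolution.MonomializationAlongValuation
import HarnessLib

/-!
# Route `RadicialJung`, crux `CleanModels` (stmt-15917), stub `stub_cleanLU3DefectNonDiscrete`, sub-line (C-div): monomialization of one
# element along a valuation in a regular local ring of dimension `≤ 3` (piece MONO, tool)

Line `Sketch` rev 24 of crux stmt-ResolutionOfSingularities-15917; lead `res-B-lead-1` g4 (workfile `Lines/Sketch_Cdiv_assembly.lean` v2,
piece MONO).  OURS; nothing here proves resolution in characteristic `p`.

`exists_localRing_monomial_of_embeddedResolution_dim` is the tree's `Literature/…/MonomializationAlongValuation.lean`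
`exists_localRing_monomial_of_embeddedResolution` (stated there for `dim R = 3`) with the dimension hypothesis relaxed to `dim R = n + 1`,
`n ≤ 2` — the proof is the same (embedded resolution of `V(x) ⊂ Spec R`, whose dimension `n ≤ 2` is what CJS Cor. 1.5 needs); the (C-div)
sub-line uses it at the residue SURFACE (`n = 1`) to make a fixed denominator a monomial along `Ō`.  Credit: the dimension-3 statement and its
proof are the Literature file's; only the two dimension lines differ.
-/

noncomputable section

set_option linter.dupNamespace false -- mandated namespace of this single-conjunct summit

open CategoryTheory CategoryTheory.Limits AlgebraicGeometry TopologicalSpace IsLocalRing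
open Literature.AlgebraicGeometry.Resolution

namespace Summit.ResolutionOfSingularities.ResolutionOfSingularities.Theorems.RadicialJung.CleanModels

universe u

/-- **Monomialization of one element along a valuation, local-ring step, dimension `n + 1 ≤ 3`** — the tree's
`exists_localRing_monomial_of_embeddedResolution` with `dim R = n + 1`, `n ≤ 2` (so that `dim V(x) ≤ n ≤ 2`); otherwise verbatim.
[cite: CossartPiltant2008, Prop. 4.1, Prop. 8.1 (HAL pp. 6–7, 21–22)] [cite: CossartJannsenSaito2020, Cor. 1.5, p. 7] -/
theorem exists_localRing_monomial_of_embeddedResolution_dim {n : ℕ} (hn : n ≤ 2)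
    (hEmb : ∀ (Z : Scheme.{u}) [IsIntegral Z] [IsNoetherian Z], Scheme.IsRegular Z →
      Scheme.IsExcellent Z → ∀ (X : Set Z), IsClosed X → X ≠ Set.univ → topologicalKrullDim X ≤ 2 →
        ∃ (Z' : Scheme.{u}) (π : Z' ⟶ Z), IsProper π ∧ Function.Surjective π.base ∧
          (∃ U : Z.Opens, (U : Set Z) = Xᶜ ∧ IsIso (π ∣_ U)) ∧
          IsStrictNormalCrossingsDivisor Z' (π.base ⁻¹' X))
    {R K E : Type u} [CommRing R] [IsRegularLocalRing R] [Field K] [Field E] [Algebra R K]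
    [Algebra K E] [Algebra R E] [IsScalarTower R K E]
    (hRK : Function.Injective (algebraMap R K)) (hexc : IsExcellentRing R)
    (hdimR : ringKrullDim R = (n + 1 : ℕ)) (OE : ValuationSubring E)
    (hRO : ∀ r : R, algebraMap R E r ∈ OE)
    (hRm : ∀ r : R, r ∈ maximalIdeal R ↔ OE.valuation (algebraMap R E r) < 1)
    (xR : R) (hxR0 : xR ≠ 0) (hxRm : xR ∈ maximalIdeal R) :
    ∃ uu : Finset E, ((uu : Set E) ⊆ Set.range (algebraMap K E)) ∧
      (∀ y ∈ Algebra.adjoin R (uu : Set E), y ∈ OE) ∧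
      ∃ (R' : Type u) (_ : CommRing R') (_ : IsRegularLocalRing R') (_ : Algebra R' E),
        Function.Injective (algebraMap R' E) ∧ (∀ r : R', algebraMap R' E r ∈ OE) ∧
        (∀ r : R', r ∈ maximalIdeal R' ↔ OE.valuation (algebraMap R' E r) < 1) ∧
        (∀ y ∈ Algebra.adjoin R (uu : Set E), y ∈ Set.range (algebraMap R' E)) ∧
        (∀ r : R', ∃ τ σ : E, τ ∈ Algebra.adjoin R (uu : Set E) ∧ σ ∈ Algebra.adjoin R (uu : Set E) ∧
          OE.valuation σ = 1 ∧ algebraMap R' E r * σ = τ) ∧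
        ∃ (d : ℕ) (z : Fin d → R') (α : Fin d → ℕ) (u : R'), IsUnit u ∧ ringKrullDim R' = d ∧
          Ideal.span (Set.range z) = maximalIdeal R' ∧
          algebraMap R E xR = algebraMap R' E (u * ∏ i, z i ^ α i) := by
  classical
  haveI : IsDomain R := isDomain_of_isRegularLocalRing R
  -- the valuation ring `O = O_E ∩ K` of `K`
  let O : ValuationSubring K := OE.comap (algebraMap K E)
  have hROK : ∀ r : R, algebraMap R K r ∈ O := fun r => by
    change algebraMap K E (algebraMap R K r) ∈ OE
    rw [← IsScalarTower.algebraMap_apply]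
    exact hRO r
  have hxRK : O.valuation (algebraMap R K xR) < 1 := by
    rw [valuation_comap_lt_one_iff OE (algebraMap K E), ← IsScalarTower.algebraMap_apply]
    exact (hRm xR).mp hxRm
  -- embedded resolution of `V(x) ⊂ Spec R`
  haveI : IsDomain (CommRingCat.of R) := ‹IsDomain R›
  haveI : IsNoetherianRing (CommRingCat.of R) := (inferInstance : IsNoetherianRing R)
  haveI : IsRegularRing (CommRingCat.of R) := isRegularRing_of_isRegularLocalRing R
  haveI hint : IsIntegral (Spec (.of R)) := inferInstance
  haveI hnoeth : IsNoetherian (Spec (.of R)) := inferInstance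
  have hregS : Scheme.IsRegular (Spec (.of R)) := Scheme.isRegular_Spec (.of R)
  have hexcS : Scheme.IsExcellent (Spec (.of R)) := Scheme.isExcellent_Spec_of_isExcellentRing R hexc
  let Xs₀ : Set (PrimeSpectrum R) := PrimeSpectrum.zeroLocus ({xR} : Set R)
  let Xs : Set (Spec (.of R)) := Xs₀
  have hXs : ∀ p : PrimeSpectrum R, (p : Spec (.of R)) ∈ Xs ↔ xR ∈ p.asIdeal := fun p => by
    change p ∈ PrimeSpectrum.zeroLocus ({xR} : Set R) ↔ _
    rw [PrimeSpectrum.mem_zeroLocus, Set.singleton_subset_iff]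
    rfl
  have hXs_eq : Xs = {p : Spec (.of R) | xR ∈ (p : PrimeSpectrum R).asIdeal} :=
    Set.ext fun p => hXs p
  have hXclosed : IsClosed Xs := PrimeSpectrum.isClosed_zeroLocus _
  have hXuniv : Xs ≠ Set.univ := by
    intro h
    have h1 : ((⊥ : PrimeSpectrum R) : Spec (.of R)) ∈ Xs := by rw [h]; trivial
    rw [hXs] at h1
    exact hxR0 (by simpa using h1)
  have hXdim : topologicalKrullDim Xs ≤ 2 :=
    (topologicalKrullDim_zeroLocus_singleton_le hxR0 hxRm (n := n) hdimR).trans (by exact_mod_cast hn)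
  obtain ⟨Z', π, hπproper, -, ⟨U, hU, hUiso⟩, hsnc⟩ :=
    hEmb (Spec (.of R)) hregS hexcS Xs hXclosed hXuniv hXdim
  haveI := hπproper
  haveI := hUiso
  have hU' : ∀ p : PrimeSpectrum R, (p : Spec (.of R)) ∈ U ↔ xR ∉ p.asIdeal := fun p => by
    have h1 := Set.ext_iff.mp hU p
    exact h1.trans (not_congr (hXs p))
  rw [hXs_eq] at hsnc
  -- the scheme step
  obtain ⟨T₂, hT₂O, hT₂fg, P₂, hP₂prime, hP₂, hT₂reg, d, z, α, u, hu, hdim₂, hspan₂, hfact₂⟩ :=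
    exists_fg_regular_monomial_of_isStrictNormalCrossingsDivisor_preimage (A := R) (K := K)
      hRK O hROK xR hxR0 hxRK U hU' hsnc
  obtain ⟨fs, hfs⟩ := hT₂fg
  -- read in `E`
  let valₐ : K →ₐ[R] E := IsScalarTower.toAlgHom R K E
  have hval' : ∀ w : K, valₐ w = algebraMap K E w := fun _ => rfl
  let uu : Finset E := fs.image (fun w : K => algebraMap K E w)
  have hT₂map : (T₂.map valₐ : Subalgebra R E) = Algebra.adjoin R (uu : Set E) := by
    rw [← hfs, AlgHom.map_adjoin, Finset.coe_image]
    rfl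
  have hT₂E : ∀ y : E, y ∈ Algebra.adjoin R (uu : Set E) ↔ ∃ τ : T₂, algebraMap K E (τ : K) = y := by
    intro y
    rw [← hT₂map, Subalgebra.mem_map]
    constructor
    · rintro ⟨w, hw, rfl⟩; exact ⟨⟨w, hw⟩, rfl⟩
    · rintro ⟨τ, rfl⟩; exact ⟨τ, τ.2, rfl⟩
  have hRuO : ∀ y : E, y ∈ Algebra.adjoin R (uu : Set E) → y ∈ OE := by
    intro y hy
    obtain ⟨τ, rfl⟩ := (hT₂E y).mp hy
    exact hT₂O τ.2
  -- the local ring `R' = (T₂)_{P₂}`, realised in `E`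
  let R' : Type u := Localization.AtPrime P₂
  haveI : IsRegularLocalRing R' := hT₂reg
  haveI : IsDomain R' := isDomain_of_isRegularLocalRing R'
  let ι : T₂ →+* E := (algebraMap K E).comp (T₂.val : T₂ →+* K)
  have hι : ∀ τ : T₂, ι τ = algebraMap K E (τ : K) := fun _ => rfl
  have hvalT : ∀ τ : T₂, OE.valuation (ι τ) ≤ 1 := fun τ =>
    (OE.valuation_le_one_iff _).mpr (hT₂O τ.2)
  have hvP : ∀ τ : T₂, τ ∉ P₂ → OE.valuation (ι τ) = 1 := fun τ hτ => by
    have hnlt : ¬ OE.valuation (ι τ) < 1 := fun hlt => hτ ((hP₂ τ).mpr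
      ((valuation_comap_lt_one_iff OE (algebraMap K E) (τ : K)).mpr hlt))
    exact le_antisymm (hvalT τ) (not_lt.mp hnlt)
  have hunits : ∀ y : P₂.primeCompl, IsUnit (ι y) := fun y => by
    rw [isUnit_iff_ne_zero]
    intro h0
    have h1 := hvP y y.2
    rw [h0, map_zero] at h1
    exact zero_ne_one h1
  letI : Algebra T₂ E := ι.toAlgebra
  let φ : R' →+* E := IsLocalization.lift (M := P₂.primeCompl) hunits
  letI algR'E : Algebra R' E := φ.toAlgebra
  have hφ : ∀ a : T₂, algebraMap R' E (algebraMap T₂ R' a) = ι a := fun a =>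
    IsLocalization.lift_eq hunits a
  have hval : ∀ (a : T₂) (b : P₂.primeCompl),
      algebraMap R' E (IsLocalization.mk' R' a b) = ι a * (ι b)⁻¹ ∧ OE.valuation (ι b) = 1 := by
    intro a b
    have hb : OE.valuation (ι b) = 1 := hvP b b.2
    have hb0 : ι b ≠ 0 := fun h0 => by rw [h0, map_zero] at hb; exact zero_ne_one hb
    refine ⟨?_, hb⟩
    have h1 := IsLocalization.mk'_spec R' a b
    have h2 := congrArg (algebraMap R' E) h1
    rw [map_mul, hφ, hφ] at h2
    rw [← h2, mul_inv_cancel_right₀ hb0]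
  have hR'O : ∀ r : R', algebraMap R' E r ∈ OE := by
    intro r
    obtain ⟨⟨a, b⟩, rfl⟩ := IsLocalization.mk'_surjective P₂.primeCompl r
    obtain ⟨hab, hb⟩ := hval a b
    rw [hab]
    refine mul_mem (hT₂O a.2) ?_
    rw [← OE.valuation_le_one_iff, map_inv₀, hb, inv_one]
  have hinjR' : Function.Injective (algebraMap R' E) := by
    change Function.Injective (IsLocalization.lift (M := P₂.primeCompl) hunits)
    refine (IsLocalization.lift_injective_iff _).mpr fun a b => ⟨fun h => ?_, fun h => ?_⟩
    · rw [IsLocalization.injective R' P₂.primeCompl_le_nonZeroDivisors h]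
    · have h' : (a : K) = (b : K) := (algebraMap K E).injective h
      rw [Subtype.ext h']
  have hR'm : ∀ r : R', r ∈ maximalIdeal R' ↔ OE.valuation (algebraMap R' E r) < 1 := by
    intro r
    obtain ⟨⟨a, b⟩, rfl⟩ := IsLocalization.mk'_surjective P₂.primeCompl r
    obtain ⟨hab, hb⟩ := hval a b
    rw [IsLocalization.AtPrime.mk'_mem_maximal_iff R' P₂ a b, hab, map_mul, map_inv₀, hb, inv_one,
      mul_one, hP₂ a]
    exact valuation_comap_lt_one_iff OE (algebraMap K E) (a : K)
  have hlow : ∀ y ∈ Algebra.adjoin R (uu : Set E), y ∈ Set.range (algebraMap R' E) := by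
    intro y hy
    obtain ⟨τ, rfl⟩ := (hT₂E y).mp hy
    exact ⟨algebraMap T₂ R' τ, hφ τ⟩
  have hup : ∀ r : R', ∃ τ σ : E, τ ∈ Algebra.adjoin R (uu : Set E) ∧
      σ ∈ Algebra.adjoin R (uu : Set E) ∧ OE.valuation σ = 1 ∧ algebraMap R' E r * σ = τ := by
    intro r
    obtain ⟨⟨a, b⟩, rfl⟩ := IsLocalization.mk'_surjective P₂.primeCompl r
    obtain ⟨hab, hb⟩ := hval a b
    have hb0 : ι b ≠ 0 := fun h0 => by rw [h0, map_zero] at hb; exact zero_ne_one hb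
    refine ⟨ι a, ι b, (hT₂E _).mpr ⟨a, rfl⟩, (hT₂E _).mpr ⟨(b : T₂), rfl⟩, hb, ?_⟩
    rw [hab, inv_mul_cancel_right₀ hb0]
  refine ⟨uu, ?_, fun y hy => hRuO y hy, R', inferInstance, inferInstance, inferInstance, hinjR',
    hR'O, hR'm, hlow, hup, d, fun i => algebraMap T₂ R' (z i), α, u, hu, hdim₂, ?_, ?_⟩
  · intro y hy
    obtain ⟨w, -, rfl⟩ := Finset.mem_image.mp (Finset.mem_coe.mp hy)
    exact ⟨w, rfl⟩
  · rw [← hspan₂]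
  · rw [← hfact₂, IsScalarTower.algebraMap_apply R T₂ R', hφ, hι, Subalgebra.coe_algebraMap,
      ← IsScalarTower.algebraMap_apply]

end Summit.ResolutionOfSingularities.ResolutionOfSingularities.Theorems.RadicialJung.CleanModels

end
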